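import Mathlib
import Summits.Ventures.PercRepro2.CoinStarAlg
import Summits.Ventures.PercRepro2.CoinStarDefs
import Summits.Ventures.PercRepro2.CoinStarCore

/-!
# The star-core theorem on the LITERAL OR-FORK WITH ENTRIES INTO w — an instantiation check
(blind cell PercRepro2, night-2 g7; NIGHT2-DARC.md §30.6–§30.7)

A concrete coin system on `Fin 9` (s = 0, a = 1, b = 2, u = 3, w = 4, v₀ = 5, v₁ = 6, v₂ = 7,
t = 8) with twelve single-arc coins: the star core s → a, s → b, s → u; the marker entries
a → v₁, b → v₂ AND the entries INTO w a → w, b → w (the «entries into w» case that was open after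
g6, §29.4/§29.6); the diamond head w → v₀ → {v₁, v₂} → t (arm, inner arcs, leaves — ALL random).
Every structural hypothesis of `darc_of_starCore` is discharged by `decide`; the theorem gives row
2′DARC at the arc `u → w` for EVERY probability vector `p` under the two non-degeneracy hypotheses
(the reduced masses `M₀`, `M'` of the star core positive).  The point of the file: the hypotheses of
the star-core theorem are satisfiable and they hold on the family of §28.2 / §29.9 with the entries
into `w` that no earlier theorem of the row covered.
-/

namespace Summit.Ventures.PercRepro2.Coin

namespace StarCoreExample

open Classical

/-- The twelve coins of the example. -/
def arcsEx : Fin 12 → Finset (Fin 9 × Fin 9)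
  | 0 => {(0, 1)}   -- c a : s → a
  | 1 => {(0, 2)}   -- c b : s → b
  | 2 => {(0, 3)}   -- c u : s → u
  | 3 => {(1, 6)}   -- a → v₁ (marker entry into the first branch)
  | 4 => {(2, 7)}   -- b → v₂ (marker entry into the second branch)
  | 5 => {(1, 4)}   -- a → w (entry into w)
  | 6 => {(2, 4)}   -- b → w (entry into w)
  | 7 => {(4, 5)}   -- arm w → v₀
  | 8 => {(5, 6)}   -- v₀ → v₁
  | 9 => {(5, 7)}   -- v₀ → v₂
  | 10 => {(6, 8)}  -- v₁ → t
  | 11 => {(7, 8)}  -- v₂ → t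

/-- The star coins: `c v = v − 1` for `v ∈ {1, 2, 3}`. -/
def cEx : Fin 9 → Fin 12
  | 1 => 0
  | 2 => 1
  | 3 => 2
  | _ => 0

/-- Every coin is a single arc, so `SameEnds` holds. -/
lemma sameEnds_ex : SameEnds arcsEx := by
  intro e xy hxy x'y' hx'y'
  fin_cases e <;> simp [arcsEx] at hxy hx'y' <;> subst hxy <;> subst hx'y' <;>
    exact ⟨Or.inl rfl, Or.inr rfl⟩

/-- The core `{a, b, u}` is a star core of `s`. -/
lemma starCore_ex : StarCore arcsEx 0 {1, 2, 3} cEx where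
  star := by decide
  inj := by
    intro x hx y hy hxy
    simp only [Finset.coe_insert, Finset.coe_singleton, Set.mem_insert_iff,
      Set.mem_singleton_iff] at hx hy
    rcases hx with rfl | rfl | rfl <;> rcases hy with rfl | rfl | rfl <;> first | rfl | (simp [cEx] at hxy)
  out_s := by decide
  into_s := by decide
  into_C := by decide
  s_notin := by decide

/-- **Row 2′DARC at the arc `u → w` of the literal OR-fork with entries into `w`, for every
probability vector** (non-degeneracy of the two reduced star masses assumed). -/
theorem darc_starCore_example {R : Type*} [Field R] [LinearOrder R] [IsStrictOrderedRing R]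
    (p : Fin 12 → R) (hp : IsProbVec p)
    (hM₀ : 0 < ∑ L ∈ (({1, 2, 3} : Finset (Fin 9)).erase 3).powerset,
      leafLaw (({1, 2, 3} : Finset (Fin 9)).erase 3) (fun v => p (cEx v)) L *
        prob p (starAvoidEvent arcsEx 0 8 L))
    (hM' : 0 < ∑ L ∈ (({1, 2, 3} : Finset (Fin 9)).erase 3).powerset,
      leafLaw (({1, 2, 3} : Finset (Fin 9)).erase 3) (fun v => p (cEx v)) L *
        prob p (starAvoidEvent arcsEx 0 8 (insert 4 (insert 3 L)))) :
    DARC p arcsEx 0 {8} 1 2 3 4 :=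
  darc_of_starCore p hp sameEnds_ex starCore_ex (by decide) (by decide) (by decide) (by decide)
    (by decide) (by decide) (by decide) (by decide) hM₀ hM'

end StarCoreExample

end Summit.Ventures.PercRepro2.Coin
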